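import Literature.Topology.FourManifolds.StableNormalFrameLinAlg
import Mathlib.Analysis.SpecificLimits.Normed
import Mathlib.Analysis.Normed.Operator.Banach
import Mathlib.Topology.MetricSpace.Thickening
import Mathlib.Topology.Algebra.Module.FiniteDimension
import Mathlib.Analysis.Normed.Module.FiniteDimension
import HarnessLib

/-!
# The stable normal frame: full rank, its stability under perturbation, and transversality

Continuation of `StableNormalFrameLinAlg.lean` (Kervaire–Milnor 1963, proof of Thm. 3.1; Hirsch,
*Differential Topology* (1976), Ch. 4 §5–6). For the push-forward stable tangent frame
`σⱼ = (tⱼ, rⱼ)` and a frame `ν : K → V × ℝ^κ` we consider the linear map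

  `frameMap t ν (α, σ) = (∑ⱼ αⱼ tⱼ, 0) + ∑ₖ σₖ νₖ : ℝ^κ × ℝ^K → V × ℝ^κ`

(all data chart-free and continuous on the manifold) and prove:

* `normalVec_add`, `normalVec_smul`, `sum_smul_normalVec` — linearity of the frame map of
  `StableNormalFrameLinAlg.lean`;
* **`surjective_frameMap_normalVec`** — the exact frame `νₖ = normalVec t r bₖ μₖ` over a spanning
  family `(bₖ, μₖ)` of `V × ℝ` has surjective `frameMap` ("full rank");
* **`isOpen_setOf_surjective`**, **`exists_forall_norm_sub_lt_surjective`** — surjective continuous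
  linear maps form an open set (right inverse and a Neumann series), so a continuous compact family
  of full-rank frames stays full rank under uniformly small perturbations;
  `norm_frameMap_sub_frameMap_le` bounds the perturbation of `frameMap` by that of the frame;
* **`injective_tubeDeriv_of_surjective_frameMap`** — full rank implies TRANSVERSALITY: for an
  injective `τ` with range `⊆ span t` admitting a nontrivial relation `∑ α⁰ⱼ tⱼ = 0` (here
  `rank τ = card κ − 1`) and `card K = dim V + 1`, the tube differential
  `(v, σ) ↦ (τ v, 0) + ∑ σₖ νₖ` is injective (dimension count: the kernel of `frameMap` is the line
  of the relation).

Everything is proved; no named facts.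

## References

* M. Kervaire, J. Milnor, *Groups of homotopy spheres I*, Ann. of Math. 77 (1963), §3 proof of
  Thm. 3.1. [KervaireMilnorAnnals1963]
* M. W. Hirsch, *Differential Topology*, GTM 33, Springer 1976, Ch. 4 §5–6. [Hirsch1976]
-/

noncomputable section

open Matrix Finset Metric Set
open scoped RealInnerProductSpace

namespace Literature.Topology.FourManifolds

namespace StableNormalFrame

variable {V : Type*} [NormedAddCommGroup V] [InnerProductSpace ℝ V]
variable {κ : Type*} [Fintype κ] [DecidableEq κ] {K : Type*} [Fintype K]

/-! ### Linearity of the frame map -/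

/-- `normalVec` is additive in `(b, μ)`. [folklore] -/
lemma normalVec_add (t : κ → V) (r : κ → ℝ) (b b' : V) (μ μ' : ℝ) :
    normalVec t r (b + b') (μ + μ') = normalVec t r b μ + normalVec t r b' μ' := by
  have h := projCoord_add t r b b' 0 0
  rw [add_zero] at h
  rw [normalVec, normalVec, normalVec, h, Prod.mk_add_mk]
  congr 1
  · simp only [Pi.add_apply, add_smul, Finset.sum_add_distrib]; abel
  · rw [add_smul]; abel

/-- `normalVec` is homogeneous in `(b, μ)`. [folklore] -/
lemma normalVec_smul (t : κ → V) (r : κ → ℝ) (c : ℝ) (b : V) (μ : ℝ) :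
    normalVec t r (c • b) (c * μ) = c • normalVec t r b μ := by
  have h := projCoord_smul t r c b 0
  rw [mul_zero] at h
  simp only [normalVec, h, Prod.smul_mk, smul_sub, Finset.smul_sum, Pi.smul_apply, smul_eq_mul,
    mul_smul, smul_add]

/-- Linear combinations of frame vectors: `∑ σₖ normalVec (bₖ, μₖ) = normalVec (∑ σₖ bₖ, ∑ σₖ μₖ)`.
[folklore] -/
lemma sum_smul_normalVec (t : κ → V) (r : κ → ℝ) (b : K → V) (μ : K → ℝ) (σ : K → ℝ) :
    ∑ k, σ k • normalVec t r (b k) (μ k) = normalVec t r (∑ k, σ k • b k) (∑ k, σ k * μ k) := by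
  classical
  induction (Finset.univ : Finset K) using Finset.induction_on with
  | empty =>
    simp only [Finset.sum_empty]
    have := normalVec_smul t r 0 0 0
    rw [zero_smul, zero_mul, zero_smul] at this
    exact this.symm
  | insert k s hk ih =>
    rw [Finset.sum_insert hk, Finset.sum_insert hk, Finset.sum_insert hk, ih, normalVec_add,
      normalVec_smul]

/-! ### The frame map and its full rank for the exact frame -/

variable (t : κ → V) (ν : K → V × (κ → ℝ)) in
/-- **The frame map** `(α, σ) ↦ (∑ αⱼ tⱼ, 0) + ∑ σₖ νₖ` (a continuous linear map between
finite-dimensional spaces). [folklore] -/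
def frameMap : ((κ → ℝ) × (K → ℝ)) →ₗ[ℝ] V × (κ → ℝ) where
  toFun p := ((∑ j, p.1 j • t j, 0) : V × (κ → ℝ)) + ∑ k, p.2 k • ν k
  map_add' p q := by
    simp only [Prod.fst_add, Prod.snd_add, Pi.add_apply, add_smul, Finset.sum_add_distrib]
    rw [show ((∑ j, p.1 j • t j + ∑ j, q.1 j • t j, 0) : V × (κ → ℝ)) =
      (∑ j, p.1 j • t j, 0) + (∑ j, q.1 j • t j, 0) from by simp]
    abel
  map_smul' c p := by
    simp only [Prod.smul_fst, Prod.smul_snd, Pi.smul_apply, smul_eq_mul, mul_smul, ← Finset.smul_sum,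
      RingHom.id_apply, smul_add]
    congr 1
    simp [Prod.smul_mk, Finset.smul_sum]

omit [DecidableEq κ] in
/-- Evaluation of the frame map. [folklore] -/
lemma frameMap_apply (t : κ → V) (ν : K → V × (κ → ℝ)) (α : κ → ℝ) (σ : K → ℝ) :
    frameMap t ν (α, σ) = ((∑ j, α j • t j, 0) : V × (κ → ℝ)) + ∑ k, σ k • ν k := rfl

/-- **The exact stable normal frame has full rank**: for `νₖ = normalVec t r bₖ μₖ` with `(bₖ, μₖ)`
spanning `V × ℝ`, `frameMap t ν` is onto (`normalVec_spanning`). [cite: KervaireMilnorAnnals1963, §3 proof of Thm. 3.1] -/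
theorem surjective_frameMap_normalVec {t : κ → V} {r : κ → ℝ} (h : IsUnit (gram t r).det)
    (hv : UnitVertical t r) {b : K → V} {μ : K → ℝ}
    (hspan : ∀ (b' : V) (μ' : ℝ), ∃ σ : K → ℝ, (∑ k, σ k • b k) = b' ∧ (∑ k, σ k * μ k) = μ') :
    Function.Surjective (frameMap t fun k => normalVec t r (b k) (μ k)) := by
  rintro ⟨v, c⟩
  obtain ⟨u, hu, b', μ', heq⟩ := normalVec_spanning h hv v c
  obtain ⟨α, rfl⟩ := (Submodule.mem_span_range_iff_exists_fun ℝ).1 hu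
  obtain ⟨σ, hb, hμ⟩ := hspan b' μ'
  refine ⟨(α, σ), ?_⟩
  rw [frameMap_apply, sum_smul_normalVec, hb, hμ, ← heq]

/-! ### Surjective linear maps form an open set -/

section Open

variable {P Q : Type*} [NormedAddCommGroup P] [NormedSpace ℝ P] [NormedAddCommGroup Q]
  [NormedSpace ℝ Q] [FiniteDimensional ℝ P] [FiniteDimensional ℝ Q]

omit [FiniteDimensional ℝ P] in
/-- **Surjectivity of linear maps is an open condition** (finite dimensions): if `f` is onto with
right inverse `g`, every `f'` with `‖f' − f‖ < ‖g‖⁻¹` is onto, since `f' ∘ g = 1 + (f' − f) ∘ g` is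
invertible (Neumann series). [folklore] -/
theorem isOpen_setOf_surjective : IsOpen {f : P →L[ℝ] Q | Function.Surjective f} := by
  rw [Metric.isOpen_iff]
  intro f hf
  obtain ⟨g, hg⟩ := ContinuousLinearMap.exists_rightInverse_of_surjective f
    (LinearMap.range_eq_top.2 hf)
  by_cases hg0 : ‖g‖ = 0
  · -- then `Q` is trivial-ish: `1 = f ∘ g` has norm `0`, every map is surjective
    refine ⟨1, one_pos, fun f' _ q => ⟨g q, ?_⟩⟩
    have hq : q = f (g q) := by
      have := congrArg (fun h : Q →L[ℝ] Q => h q) hg; simpa using this.symm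
    have hgq : g q = 0 := by
      have := g.le_opNorm q; rw [hg0, zero_mul] at this
      exact norm_le_zero_iff.1 this
    rw [hgq, map_zero]
    rw [hgq, map_zero] at hq
    exact hq.symm
  · have hgpos : 0 < ‖g‖ := lt_of_le_of_ne (norm_nonneg g) (Ne.symm hg0)
    refine ⟨‖g‖⁻¹, inv_pos.2 hgpos, fun f' hf' q => ?_⟩
    -- `u = f' ∘ g = 1 - (-(f' - f) ∘ g)` is a unit
    have hsmall : ‖-((f' - f).comp g)‖ < 1 := by
      rw [norm_neg]
      refine lt_of_le_of_lt (ContinuousLinearMap.opNorm_comp_le _ _) ?_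
      rw [mem_ball, dist_eq_norm] at hf'
      calc ‖f' - f‖ * ‖g‖ < ‖g‖⁻¹ * ‖g‖ := by gcongr
        _ = 1 := inv_mul_cancel₀ hg0
    haveI : CompleteSpace (Q →L[ℝ] Q) := FiniteDimensional.complete ℝ _
    set u := Units.oneSub (-((f' - f).comp g)) hsmall with hu
    have hu' : (u : Q →L[ℝ] Q) = f'.comp g := by
      rw [hu, Units.val_oneSub, sub_neg_eq_add, ContinuousLinearMap.sub_comp, hg,
        show ContinuousLinearMap.id ℝ Q = (1 : Q →L[ℝ] Q) from rfl]
      abel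
    -- `f' (g (u⁻¹ q)) = q`
    refine ⟨g ((↑u⁻¹ : Q →L[ℝ] Q) q), ?_⟩
    have := congrArg (fun h : Q →L[ℝ] Q => h q) u.mul_inv
    change (u : Q →L[ℝ] Q) ((↑u⁻¹ : Q →L[ℝ] Q) q) = q at this
    rw [hu'] at this
    exact this

omit [FiniteDimensional ℝ P] in
/-- **Uniform stability of full rank along a compact family**: for a continuous family
`Ξ : X → (P →L Q)` of surjective maps on a compact space there is `δ > 0` such that every `Ξ'`
with `‖Ξ' − Ξ x‖ < δ` for some `x` is surjective. [folklore] -/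
theorem exists_forall_norm_sub_lt_surjective {X : Type*} [TopologicalSpace X] [CompactSpace X]
    {Ξ : X → P →L[ℝ] Q} (hΞ : Continuous Ξ) (hs : ∀ x, Function.Surjective (Ξ x)) :
    ∃ δ > 0, ∀ (x : X) (Ξ' : P →L[ℝ] Q), ‖Ξ' - Ξ x‖ < δ → Function.Surjective Ξ' := by
  have hK : IsCompact (Set.range Ξ) := isCompact_range hΞ
  obtain ⟨δ, hδ, hsub⟩ := hK.exists_thickening_subset_open isOpen_setOf_surjective
    (by rintro _ ⟨x, rfl⟩; exact hs x)
  refine ⟨δ, hδ, fun x Ξ' hd => hsub (Metric.mem_thickening_iff.2 ⟨Ξ x, ⟨x, rfl⟩, ?_⟩)⟩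
  rwa [dist_eq_norm]

end Open

/-! ### Perturbing the frame perturbs the frame map little -/

/-- The frame map as a continuous linear map. [folklore] -/
def frameMapL (t : κ → V) (ν : K → V × (κ → ℝ)) : ((κ → ℝ) × (K → ℝ)) →L[ℝ] V × (κ → ℝ) :=
  LinearMap.toContinuousLinearMap (frameMap t ν)

omit [DecidableEq κ] in
/-- `frameMapL` is `frameMap`. [folklore] -/
@[simp] lemma frameMapL_apply (t : κ → V) (ν : K → V × (κ → ℝ)) (p : (κ → ℝ) × (K → ℝ)) :
    frameMapL t ν p = frameMap t ν p := rfl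

omit [DecidableEq κ] in
/-- **Perturbation bound**: `‖frameMap t ν' − frameMap t ν‖ ≤ ∑ₖ ‖ν'ₖ − νₖ‖`. [folklore] -/
theorem norm_frameMapL_sub_le (t : κ → V) (ν ν' : K → V × (κ → ℝ)) :
    ‖frameMapL t ν' - frameMapL t ν‖ ≤ ∑ k, ‖ν' k - ν k‖ := by
  refine ContinuousLinearMap.opNorm_le_bound _ (Finset.sum_nonneg fun k _ => norm_nonneg _) ?_
  rintro ⟨α, σ⟩
  have e : (frameMapL t ν' - frameMapL t ν) (α, σ) = ∑ k, σ k • (ν' k - ν k) := by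
    change frameMap t ν' (α, σ) - frameMap t ν (α, σ) = _
    rw [frameMap_apply, frameMap_apply, add_sub_add_left_eq_sub, ← Finset.sum_sub_distrib]
    refine Finset.sum_congr rfl fun k _ => ?_
    rw [smul_sub]
  rw [e]
  calc ‖∑ k, σ k • (ν' k - ν k)‖ ≤ ∑ k, ‖σ k • (ν' k - ν k)‖ := norm_sum_le _ _
    _ ≤ ∑ k, ‖ν' k - ν k‖ * ‖(α, σ)‖ := by
        refine Finset.sum_le_sum fun k _ => ?_
        rw [norm_smul, mul_comm]
        refine mul_le_mul_of_nonneg_left ?_ (norm_nonneg _)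
        exact (norm_le_pi_norm σ k).trans (le_max_right _ _)
    _ = (∑ k, ‖ν' k - ν k‖) * ‖(α, σ)‖ := by rw [Finset.sum_mul]

omit [DecidableEq κ] in
/-- The frame map depends continuously on a continuously varying frame. [folklore] -/
theorem continuous_frameMapL {X : Type*} [TopologicalSpace X] {t : X → κ → V}
    {ν : X → K → V × (κ → ℝ)} (ht : ∀ j, Continuous fun x => t x j)
    (hν : ∀ k, Continuous fun x => ν x k) : Continuous fun x => frameMapL (t x) (ν x) := by
  -- continuity of a CLM-valued map in finite dimensions: pointwise continuity suffices
  refine continuous_clm_apply.2 fun p => ?_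
  obtain ⟨α, σ⟩ := p
  change Continuous fun x => ((∑ j, α j • t x j, 0) : V × (κ → ℝ)) + ∑ k, σ k • ν x k
  refine (Continuous.prodMk (continuous_finsetSum _ fun j _ => (ht j).const_smul (α j))
    continuous_const).add (continuous_finsetSum _ fun k _ => (hν k).const_smul (σ k))

/-! ### Full rank implies transversality of the tube differential -/

omit [DecidableEq κ] in
/-- **Full rank ⇒ transversality** (Kervaire–Milnor 1963, proof of Thm. 3.1; the dimension
count): let `τ : Eₘ → V` be injective with `τ v ∈ span t` for all `v`, suppose the `tⱼ` satisfy a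
nontrivial relation `∑ α⁰ⱼ tⱼ = 0`, `card K = dim V + 1`, and `frameMap t ν` is onto. Then
`(v, σ) ↦ (τ v, 0) + ∑ σₖ νₖ` is injective. Indeed the kernel of `frameMap` is then the line
spanned by `(α⁰, 0)`. [cite: KervaireMilnorAnnals1963, §3 proof of Thm. 3.1] -/
theorem injective_tubeDeriv_of_surjective_frameMap [FiniteDimensional ℝ V] {Em : Type*}
    [AddCommGroup Em] [Module ℝ Em]
    {t : κ → V} {ν : K → V × (κ → ℝ)} (τ : Em →ₗ[ℝ] V) (hτ : Function.Injective τ)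
    (hrange : ∀ v, τ v ∈ Submodule.span ℝ (Set.range t))
    (hrel : ∃ α₀ : κ → ℝ, α₀ ≠ 0 ∧ ∑ j, α₀ j • t j = 0)
    (hcard : Fintype.card K = Module.finrank ℝ V + 1)
    (hsurj : Function.Surjective (frameMap t ν)) :
    Function.Injective fun p : Em × (K → ℝ) => ((τ p.1, 0) : V × (κ → ℝ)) + ∑ k, p.2 k • ν k := by
  -- the kernel of `frameMap` is one-dimensional
  have hker : Module.finrank ℝ (LinearMap.ker (frameMap t ν)) = 1 := by
    have h1 := LinearMap.finrank_range_add_finrank_ker (frameMap t ν)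
    rw [LinearMap.range_eq_top.2 hsurj, finrank_top, Module.finrank_prod, Module.finrank_prod,
      Module.finrank_fintype_fun_eq_card, Module.finrank_fintype_fun_eq_card, hcard] at h1
    omega
  obtain ⟨α₀, hα₀, hrel₀⟩ := hrel
  have hmem₀ : ((α₀, 0) : (κ → ℝ) × (K → ℝ)) ∈ LinearMap.ker (frameMap t ν) := by
    rw [LinearMap.mem_ker, frameMap_apply, hrel₀]; simp
  have hne₀ : ((α₀, 0) : (κ → ℝ) × (K → ℝ)) ≠ 0 := fun h => hα₀ (congrArg Prod.fst h)
  -- every kernel element is a multiple of `(α₀, 0)`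
  have hline : ∀ p ∈ LinearMap.ker (frameMap t ν), ∃ c : ℝ, p = c • (α₀, 0) := by
    intro p hp
    have := (finrank_eq_one_iff_of_nonzero' (⟨(α₀, 0), hmem₀⟩ : LinearMap.ker (frameMap t ν))
      (by simpa using hne₀)).1 hker ⟨p, hp⟩
    obtain ⟨c, hc⟩ := this
    exact ⟨c, by simpa using congrArg Subtype.val hc.symm⟩
  -- injectivity: it suffices that the kernel of the (linear) map is trivial
  have hlin : ∀ p q : Em × (K → ℝ),
      (((τ p.1, 0) : V × (κ → ℝ)) + ∑ k, p.2 k • ν k) - (((τ q.1, 0) : V × (κ → ℝ)) + ∑ k, q.2 k • ν k) =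
        ((τ (p.1 - q.1), 0) : V × (κ → ℝ)) + ∑ k, (p.2 - q.2) k • ν k := by
    intro p q
    simp only [map_sub, Pi.sub_apply, sub_smul, Finset.sum_sub_distrib]
    rw [show ((τ p.1 - τ q.1, 0) : V × (κ → ℝ)) = (τ p.1, 0) - (τ q.1, 0) from by simp]
    abel
  intro p q hpq
  have hzero : ((τ (p.1 - q.1), 0) : V × (κ → ℝ)) + ∑ k, (p.2 - q.2) k • ν k = 0 := by
    rw [← hlin, sub_eq_zero]; exact hpq
  set v := p.1 - q.1 with hv
  set σ := p.2 - q.2 with hσ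
  obtain ⟨α, hα⟩ := (Submodule.mem_span_range_iff_exists_fun ℝ).1 (hrange v)
  have hmem : ((α, σ) : (κ → ℝ) × (K → ℝ)) ∈ LinearMap.ker (frameMap t ν) := by
    rw [LinearMap.mem_ker, frameMap_apply, hα]; exact hzero
  obtain ⟨c, hc⟩ := hline _ hmem
  have hσ0 : σ = 0 := by
    have := congrArg Prod.snd hc; simpa using this
  have hτv : τ v = 0 := by
    have h := hzero
    rw [hσ0] at h
    simpa using congrArg Prod.fst h
  have hv0 : v = 0 := hτ (by rw [hτv, map_zero])
  exact Prod.ext (sub_eq_zero.1 hv0) (sub_eq_zero.1 hσ0)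

end StableNormalFrame

end Literature.Topology.FourManifolds
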